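import Mathlib.Algebra.MvPolynomial.Monad
import Literature.Computability.AlgebraicComplexity.KIReductionCorrectness
import Literature.Computability.AlgebraicComplexity.StandardFamilies
import HarnessLib

/-!
# The Laplace chain of the permanent in a FIXED variable layout: soundness of the
# Kabanets–Impagliazzo row-expansion identities, over any commutative ring

Pure algebra behind the `∃·coRP` verifier of Bläser–Ikenmeyer–Jindal–Lysikov 2018, Thm. 6
(`Barriers/ValiantsHypothesis/BIJL18Thm6Verifier*.lean`): the verifier evaluates guessed circuit
codes MODULO A PRIME `p` at random points of ONE `n × n` layout (matrix variable `(a, b)` at the flat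
position `a·n + b`, for every level `i ≤ n` of the chain), and checks Kabanets–Impagliazzo's
downward self-reduction of the permanent (STOC 2003, Lemma 11, identities (1)–(2)):

  `Q₀ = 1`,  `Q_{i+1} = Σ_{j ≤ i} x_{0j} · Q_i(minor_j)`  (`i < n`),

where `minor_j` deletes row `0` and column `j`. In the fixed layout the minor is the VARIABLE
SUBSTITUTION `x_{ab} ↦ x_{(a+1), b + [j ≤ b]}` (`minorSubst`), read by the verifier as a gather of
point blocks at the flat source positions `minorSrc n j a b = (a+1)·n + b + [j ≤ b]` (positions
`≥ n²` read the constant `0`). This file proves, over any commutative ring `F`: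

* `varAtFlat`, `minorSrc`, `minorSubst`, `cornerMat`/`cornerPer` (the permanent of the top-left
  `i × i` block in the layout), `cornerPer_self : cornerPer F n n = perPoly (Fin n) F`;
* **`cornerPer_succ`** — the Laplace expansion along row `0` in exactly the shape of the level
  identity (`Matrix.permanent_eq_sum_row_zero`);
* **`chain_sound`** — any sequence `Q` satisfying the identities has `Q i = cornerPer F n i`
  (`i ≤ n`), in particular `Q n = perPoly (Fin n) F` (`chain_sound_perPoly`);
* degree bookkeeping for the Schwartz–Zippel step: `totalDegree_minorSubst_le`,
  `totalDegree_levelRHS_le`;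
* evaluation bookkeeping: `eval_varAtFlat`, `eval_minorSubst` (the substituted polynomial at a
  point `R` is the polynomial at the gathered point `ab ↦ R` read at `minorSrc`).

Twin (not imported, different data): `KIReduction.genPer_succ` / `Q_eq_genPer`
(`KIReductionCorrectness.lean`) prove the same expansion over `ℤ` in the variables `Fin (n·n)` for
Kabanets–Impagliazzo's WRITTEN instance; here the variables are `Fin n × Fin n` (those of
`perPoly (Fin n) F`) over an arbitrary `F` (the verifier works over `ZMod p`).
HONEST FRAMING: bookkeeping for a conditional barrier theorem; `VP ≠ VNP` is NOT proved.

## References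

* V. Kabanets, R. Impagliazzo, *Derandomizing polynomial identity tests means proving circuit
  lower bounds*, STOC 2003, Lemma 11 (p. 358) [KabanetsImpagliazzo2003].
* M. Bläser, C. Ikenmeyer, G. Jindal, V. Lysikov, STOC 2018 = ECCC TR18-064, §6 (proof of Thms. 5–6)
  [BlaserIkenmeyerJindalLysikov2018].
* H. Minc, *Permanents*, Encyclopedia Math. Appl. 6 (1978), §1.2 (Laplace expansion) [Minc1978].
-/

noncomputable section

namespace Literature.Computability.AlgebraicComplexity

namespace PermanentChain

open MvPolynomial Finset

variable (F : Type*) [CommRing F] (n : ℕ)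

/-! ### The fixed layout -/

/-- **The matrix variable at a flat position** `s` of the `n × n` layout (`(s / n, s % n)`), or the
constant `0` when `s ≥ n²`. [cite: KabanetsImpagliazzo2003, Lemma 11 (p. 358)] -/
def varAtFlat (s : ℕ) : MvPolynomial (Fin n × Fin n) F :=
  if h : s < n * n then
    X (⟨s / n, Nat.div_lt_of_lt_mul h⟩, ⟨s % n, Nat.mod_lt _ (Nat.pos_of_ne_zero fun h0 => by
      subst h0; simp at h)⟩)
  else 0

/-- **Source position of the minor gather**: the entry `(a, b)` of the minor (row `0` and column
`j` deleted) sits at the flat position `(a+1)·n + b + [j ≤ b]` of the full matrix.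
[cite: KabanetsImpagliazzo2003, Lemma 11 (2) (p. 358)] -/
def minorSrc (j a b : ℕ) : ℕ := (a + 1) * n + b + (if j ≤ b then 1 else 0)

/-- **The minor substitution** `x_{ab} ↦ x at minorSrc n j a b` (an algebra endomorphism).
[cite: KabanetsImpagliazzo2003, Lemma 11 (2) (p. 358)] -/
def minorSubst (j : ℕ) : MvPolynomial (Fin n × Fin n) F →ₐ[F] MvPolynomial (Fin n × Fin n) F :=
  aeval fun ab : Fin n × Fin n => varAtFlat F n (minorSrc n j ab.1.val ab.2.val)

/-- The top-left `i × i` block of the generic matrix in the layout (junk `0` out of range, i.e.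
never for `i ≤ n`). [cite: KabanetsImpagliazzo2003, Lemma 11 (p. 358)] -/
def cornerMat (i : ℕ) : Matrix (Fin i) (Fin i) (MvPolynomial (Fin n × Fin n) F) :=
  fun a b => varAtFlat F n (a.val * n + b.val)

/-- **The permanent of the top-left `i × i` block** ("`pᵢ` computes Perm on `i × i` matrices").
[cite: KabanetsImpagliazzo2003, Lemma 11 (p. 358)] -/
def cornerPer (i : ℕ) : MvPolynomial (Fin n × Fin n) F := (cornerMat F n i).permanent

/-- **The right-hand side of the level identity** `i → i + 1`:
`Σ_{j < i+1} x_{0j} · minorSubst j Q`. [cite: KabanetsImpagliazzo2003, Lemma 11 (2) (p. 358)] -/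
def levelRHS (i : ℕ) (Q : MvPolynomial (Fin n × Fin n) F) : MvPolynomial (Fin n × Fin n) F :=
  ∑ j ∈ range (i + 1), varAtFlat F n j * minorSubst F n j Q

variable {F n}

/-! ### Index arithmetic (`KIReduction.idx_lt` / `idx_div` / `idx_mod`) -/

/-- `varAtFlat` at an in-range position is the variable. [cite: KabanetsImpagliazzo2003, Lemma 11 (p. 358)] -/
theorem varAtFlat_idx (a b : Fin n) : varAtFlat F n (a.val * n + b.val) = X (a, b) := by
  unfold varAtFlat
  rw [dif_pos (KIReduction.idx_lt a.isLt b.isLt)]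
  congr 1
  ext
  · exact KIReduction.idx_div b.isLt
  · exact KIReduction.idx_mod b.isLt

/-- `varAtFlat` out of range is `0`. [cite: KabanetsImpagliazzo2003, Lemma 11 (p. 358)] -/
theorem varAtFlat_of_le {s : ℕ} (hs : n * n ≤ s) : varAtFlat F n s = 0 := by
  unfold varAtFlat
  rw [dif_neg (not_lt.2 hs)]

/-- A variable has total degree `≤ 1` (also over the trivial ring). [folklore] -/
private theorem totalDegree_X_le_one {σ : Type*} (i : σ) : (X i : MvPolynomial σ F).totalDegree ≤ 1 := by
  rw [X] -- `X i = monomial (single i 1) 1`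
  exact (totalDegree_monomial_le _ _).trans (by simp)

/-- `varAtFlat s` has total degree `≤ 1`. [cite: KabanetsImpagliazzo2003, Lemma 11 (p. 358)] -/
theorem totalDegree_varAtFlat_le (s : ℕ) : (varAtFlat F n s).totalDegree ≤ 1 := by
  unfold varAtFlat
  split_ifs
  · exact totalDegree_X_le_one _
  · rw [totalDegree_zero]; exact Nat.zero_le _

/-- The minor source of an in-range entry: `minorSrc n j a b = (a+1)·n + (j.succAbove b)` for
`b < i`, `j ≤ i`. [cite: KabanetsImpagliazzo2003, Lemma 11 (p. 358)] -/
theorem minorSrc_eq {i : ℕ} (j : Fin (i + 1)) (b : Fin i) (a : ℕ) :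
    minorSrc n j.val a b.val = (a + 1) * n + (j.succAbove b).val := by
  unfold minorSrc Fin.succAbove
  by_cases h : b.val < j.val
  · rw [if_pos (show Fin.castSucc b < j from h), if_neg (by omega)]
    simp
  · rw [if_neg (show ¬ Fin.castSucc b < j from h), if_pos (by omega)]
    simp [Nat.add_assoc]

/-! ### The corner permanents -/

/-- `cornerPer 0 = 1`. [cite: KabanetsImpagliazzo2003, Lemma 11 (p. 358)] -/
theorem cornerPer_zero : cornerPer F n 0 = 1 := by
  simp [cornerPer, Matrix.permanent_isEmpty]

/-- **The full corner is the generic permanent**: `cornerPer F n n = perPoly (Fin n) F`.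
[cite: KabanetsImpagliazzo2003, Lemma 11 (p. 358)] -/
theorem cornerPer_self : cornerPer F n n = perPoly (Fin n) F := by
  unfold cornerPer perPoly
  congr 1
  ext a b : 2
  rw [cornerMat, varAtFlat_idx, Matrix.mvPolynomialX_apply]

/-- The permanent commutes with ring maps applied entrywise (one-liner re-proved to keep the import
cone small; cf. `KIReduction.permanent_map'`). [folklore] -/
private theorem permanent_map'' {m : Type*} [DecidableEq m] [Fintype m] {R S : Type*} [CommSemiring R]
    [CommSemiring S] (f : R →+* S) (A : Matrix m m R) : (A.map f).permanent = f A.permanent := by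
  simp [Matrix.permanent, map_sum, map_prod]

/-- **The minor substitution substitutes the minor**: applied to the `i × i` corner permanent it
gives the permanent of the `(i+1) × (i+1)` corner with row `0` and column `j` deleted (`i + 1 ≤ n`).
[cite: KabanetsImpagliazzo2003, Lemma 11 (2) (p. 358)] -/
theorem minorSubst_cornerPer {i : ℕ} (hi : i + 1 ≤ n) (j : Fin (i + 1)) :
    minorSubst F n j.val (cornerPer F n i) =
      ((cornerMat F n (i + 1)).submatrix Fin.succ j.succAbove).permanent := by
  unfold cornerPer
  rw [← AlgHom.coe_toRingHom, ← permanent_map'']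
  congr 1
  ext a b : 2
  have ha : a.val < n := by omega
  have hb : b.val < n := by omega
  have ha1 : a.val + 1 < n := by omega
  have hjb : (j.succAbove b).val < n := by omega
  simp only [Matrix.map_apply, Matrix.submatrix_apply, cornerMat, AlgHom.coe_toRingHom, Fin.val_succ]
  rw [show a.val * n + b.val = (⟨a.val, ha⟩ : Fin n).val * n + (⟨b.val, hb⟩ : Fin n).val from rfl,
    varAtFlat_idx, minorSubst, aeval_X, minorSrc_eq j b a.val,
    show (a.val + 1) * n + (j.succAbove b).val =
      (⟨a.val + 1, ha1⟩ : Fin n).val * n + (⟨(j.succAbove b).val, hjb⟩ : Fin n).val from rfl,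
    varAtFlat_idx]

/-- **Laplace expansion of the corner permanent in the shape of the level identity** (`i + 1 ≤ n`):
`cornerPer (i+1) = Σ_{j<i+1} x_{0j} · minorSubst j (cornerPer i)`, `x_{0j} = varAtFlat j`.
[cite: KabanetsImpagliazzo2003, Lemma 11 (2) (p. 358)] [cite: Minc1978, §1.2] -/
theorem cornerPer_succ {i : ℕ} (hi : i + 1 ≤ n) :
    cornerPer F n (i + 1) = levelRHS F n i (cornerPer F n i) := by
  rw [levelRHS, Finset.sum_range, cornerPer, Matrix.permanent_eq_sum_row_zero]
  refine Finset.sum_congr rfl fun j _ => ?_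
  rw [minorSubst_cornerPer hi j]
  congr 1
  simp [cornerMat]

/-! ### Soundness of the chain -/

/-- **Under the identities, `Q i = cornerPer i` for `i ≤ n`** (induction on `i`; Kabanets–Impagliazzo
2003, proof of Lemma 11 read backwards: "if `pₙ ≡ Perm`, then each `pᵢ` computes Perm on `i × i`
matrices"). [cite: KabanetsImpagliazzo2003, proof of Lemma 11 (p. 358)] -/
theorem chain_sound (Q : ℕ → MvPolynomial (Fin n × Fin n) F) (h0 : Q 0 = 1)
    (hstep : ∀ i, i < n → Q (i + 1) = levelRHS F n i (Q i)) : ∀ i, i ≤ n → Q i = cornerPer F n i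
  | 0, _ => by rw [h0, cornerPer_zero]
  | i + 1, hi => by
    rw [hstep i hi, cornerPer_succ hi, chain_sound Q h0 hstep i (Nat.le_of_succ_le hi)]

/-- **… in particular `Q n` is the generic permanent.** [cite: KabanetsImpagliazzo2003, Lemma 11 (p. 358)] -/
theorem chain_sound_perPoly (Q : ℕ → MvPolynomial (Fin n × Fin n) F) (h0 : Q 0 = 1)
    (hstep : ∀ i, i < n → Q (i + 1) = levelRHS F n i (Q i)) : Q n = perPoly (Fin n) F := by
  rw [chain_sound Q h0 hstep n le_rfl, cornerPer_self]

/-- **Completeness of the chain**: the corner permanents satisfy the identities.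
[cite: KabanetsImpagliazzo2003, Lemma 11 (p. 358)] -/
theorem cornerPer_chain :
    cornerPer F n 0 = 1 ∧ ∀ i, i < n → cornerPer F n (i + 1) = levelRHS F n i (cornerPer F n i) :=
  ⟨cornerPer_zero, fun _ hi => cornerPer_succ hi⟩

/-! ### Degrees -/

/-- Substituting polynomials of total degree `≤ 1` does not increase the total degree (private copy of
`Literature.Barriers.ValiantsHypothesis.totalDegree_aeval_le_of_forall_le_one`, which sits in a file
with a heavy import cone). [folklore] -/
private theorem totalDegree_aeval_le_of_forall_le_one {σ τ : Type*} (P : MvPolynomial σ F)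
    {θ : σ → MvPolynomial τ F} (hθ : ∀ i, (θ i).totalDegree ≤ 1) :
    (aeval θ P).totalDegree ≤ P.totalDegree := by
  classical
  rw [MvPolynomial.aeval_eq_bind₁]
  have hsum : MvPolynomial.bind₁ θ P =
      ∑ e ∈ P.support, MvPolynomial.bind₁ θ (monomial e (coeff e P)) := by
    conv_lhs => rw [P.as_sum]
    rw [map_sum]
  rw [hsum]
  refine totalDegree_finsetSum_le fun e he => ?_
  rw [bind₁_monomial]
  refine (totalDegree_mul _ _).trans ?_
  rw [totalDegree_C, zero_add]
  refine (totalDegree_finsetProd _ _).trans ?_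
  refine le_trans (Finset.sum_le_sum fun i _ => (totalDegree_pow _ _).trans
    (Nat.mul_le_mul_left (e i) (hθ i))) ?_
  simp only [mul_one]
  exact le_totalDegree he

/-- **The minor substitution does not increase the total degree.** [cite: KabanetsImpagliazzo2003, Lemma 11 (p. 358)] -/
theorem totalDegree_minorSubst_le (j : ℕ) (Q : MvPolynomial (Fin n × Fin n) F) :
    (minorSubst F n j Q).totalDegree ≤ Q.totalDegree :=
  totalDegree_aeval_le_of_forall_le_one Q fun _ => totalDegree_varAtFlat_le _

/-- **Degree of the right-hand side of a level identity**: `≤ deg Q + 1`. [cite: KabanetsImpagliazzo2003, Lemma 11 (p. 358)] -/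
theorem totalDegree_levelRHS_le (i : ℕ) (Q : MvPolynomial (Fin n × Fin n) F) :
    (levelRHS F n i Q).totalDegree ≤ Q.totalDegree + 1 := by
  refine totalDegree_finsetSum_le fun j _ => (totalDegree_mul _ _).trans ?_
  have h1 := totalDegree_varAtFlat_le (F := F) (n := n) j
  have h2 := totalDegree_minorSubst_le (F := F) j Q
  omega

/-- **Degree of the difference of a level identity**: `≤ max (deg Q') (deg Q + 1)`. [cite: KabanetsImpagliazzo2003, Lemma 11 (p. 358)] -/
theorem totalDegree_sub_levelRHS_le (i : ℕ) (Q Q' : MvPolynomial (Fin n × Fin n) F) :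
    (Q' - levelRHS F n i Q).totalDegree ≤ max Q'.totalDegree (Q.totalDegree + 1) :=
  (totalDegree_sub _ _).trans (max_le_max le_rfl (totalDegree_levelRHS_le i Q))

/-! ### Evaluation -/

/-- **The value of `varAtFlat s` at a point** `R`: the entry of `R` at `(s / n, s % n)`, or `0`. [cite: KabanetsImpagliazzo2003, Lemma 11 (p. 358)] -/
theorem eval_varAtFlat (R : Fin n × Fin n → F) (s : ℕ) :
    eval R (varAtFlat F n s) = if h : s < n * n then
      R (⟨s / n, Nat.div_lt_of_lt_mul h⟩, ⟨s % n, Nat.mod_lt _ (Nat.pos_of_ne_zero fun h0 => by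
        subst h0; simp at h)⟩) else 0 := by
  unfold varAtFlat
  split_ifs <;> simp

/-- The value of `varAtFlat (a·n + b)` at `R` is `R (a, b)`. [cite: KabanetsImpagliazzo2003, Lemma 11 (p. 358)] -/
theorem eval_varAtFlat_idx (R : Fin n × Fin n → F) (a b : Fin n) :
    eval R (varAtFlat F n (a.val * n + b.val)) = R (a, b) := by
  rw [varAtFlat_idx, eval_X]

/-- **The substituted polynomial at `R` is the polynomial at the gathered point**
`ab ↦ (varAtFlat (minorSrc n j a b))(R)`. [cite: KabanetsImpagliazzo2003, Lemma 11 (p. 358)] -/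
theorem eval_minorSubst (R : Fin n × Fin n → F) (j : ℕ) (Q : MvPolynomial (Fin n × Fin n) F) :
    eval R (minorSubst F n j Q) =
      eval (fun ab : Fin n × Fin n => eval R (varAtFlat F n (minorSrc n j ab.1.val ab.2.val))) Q := by
  rw [minorSubst, show eval R (aeval (fun ab : Fin n × Fin n =>
      varAtFlat F n (minorSrc n j ab.1.val ab.2.val)) Q) =
    aeval R (aeval (fun ab : Fin n × Fin n => varAtFlat F n (minorSrc n j ab.1.val ab.2.val)) Q)
    from rfl, ← AlgHom.comp_apply, comp_aeval]
  rfl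

/-- **The value of a level right-hand side at `R`.** [cite: KabanetsImpagliazzo2003, Lemma 11 (p. 358)] -/
theorem eval_levelRHS (R : Fin n × Fin n → F) (i : ℕ) (Q : MvPolynomial (Fin n × Fin n) F) :
    eval R (levelRHS F n i Q) = ∑ j ∈ range (i + 1), eval R (varAtFlat F n j) *
      eval (fun ab : Fin n × Fin n => eval R (varAtFlat F n (minorSrc n j ab.1.val ab.2.val))) Q := by
  rw [levelRHS, map_sum]
  exact Finset.sum_congr rfl fun j _ => by rw [map_mul, eval_minorSubst]

/-- **The value of the generic permanent at `R` is the permanent of `R`.** [cite: KabanetsImpagliazzo2003, Lemma 11 (p. 358)] -/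
theorem eval_perPoly (R : Fin n × Fin n → F) :
    eval R (perPoly (Fin n) F) = (Matrix.of fun a b => R (a, b)).permanent := by
  unfold perPoly
  rw [← permanent_map'']
  congr 1
  ext a b : 2
  simp [Matrix.mvPolynomialX_apply]

end PermanentChain

end Literature.Computability.AlgebraicComplexity

end
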